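import Summits.ValiantsHypothesis.ValiantsHypothesis.Theorems.ValuativeGCTValuativeBoundNegativeLoadBearing

/-!
# `ValuativeGCT.ValuativeBound` (stmt-ValiantsHypothesis-12625) — negative side, 5/5: tightness at `m = 1`

`X_pow_mem_truncation_one`: the monomial `A^δ` lies in the crux's `T_0((δ)*)` at `m = 1` (all four
clauses — a non-junk inhabitant of `T`); `truncation_one_le_span`: `T ⊆ ℂ·A^n`;
`finrank_truncation_one : dim T_0((δ)*) = 1 ≤ K_1((δ)*)`; hence the STRICT variant `K < dim T` is
FALSE (`valuativeBound_false_strict`): the bound is attained.  Elementary; no new facts.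
-/

noncomputable section

open MvPolynomial

namespace Summit.ValiantsHypothesis.Theorems.ValuativeBoundNegative

open Literature.NumberTheory.DiophantineGeometry Literature.Computability.AlgebraicComplexity

section TightAtOne

/-- A sum over `MatIdx 1` is its single term. [folklore] -/
theorem sum_matIdx_one {α : Type*} [AddCommMonoid α] (f : MatIdx 1 → α) : ∑ l, f l = f (iLast 1) :=
  Finset.sum_eq_single (iLast 1) (fun l _ hl => absurd (eq_iLast_one l) hl)
    (fun h => absurd (Finset.mem_univ _) h)

/-- The unique variable of `End(ℂ¹)`: the entry `A_{00}`. [folklore] -/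
def pOne : MatIdx 1 × MatIdx 1 := (iLast 1, iLast 1)

/-- `MatIdx 1 × MatIdx 1` has a single element. [folklore] -/
theorem eq_pOne (p : MatIdx 1 × MatIdx 1) : p = pOne :=
  Prod.ext (eq_iLast_one _) (eq_iLast_one _)

/-- `det_1 = x`. [folklore] -/
theorem detFormLex_one : detFormLex ℂ 1 = X (iLast 1) := by
  rw [detFormLex, detPoly, AlgHom.map_det, Matrix.det_fin_one]
  simp only [AlgHom.mapMatrix_apply, Matrix.map_apply, Matrix.mvPolynomialX_apply, rename_X]
  rw [eq_iLast_one (toLex (0, 0))]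

/-- The End-stabiliser of `det_1 = x` is trivial: `M·x = x ⇒ M₀₀ = 1`. [folklore] -/
theorem apply_eq_one_of_linSubst_detFormLex_one {M : Matrix (MatIdx 1) (MatIdx 1) ℂ}
    (hM : linSubst (MatIdx 1) ℂ M (detFormLex ℂ 1) = detFormLex ℂ 1) : M (iLast 1) (iLast 1) = 1 := by
  rw [detFormLex_one, linSubst_X, sum_matIdx_one] at hM
  have h := congrArg (coeff (Finsupp.single (iLast 1) 1)) hM
  rw [coeff_smul, smul_eq_mul] at h
  simpa using h

/-- **Non-junk inhabitant of `T`.** At `m = 1`, `U = 0` (`r = 0`, threshold `δ`), the monomial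
`A^δ` lies in the crux's truncation of weight `(δ)* = (-δ)`: it is homogeneous of degree `δ`,
vanishes to order `δ` at `L_0 = {0}`, is fixed by the (trivial) stabiliser of `det_1`, and
`(g⁻¹A)^δ = g^{-δ} A^δ`. [folklore] -/
theorem X_pow_mem_truncation_one (δ : ℕ) :
    (X pOne : MvPolynomial (MatIdx 1 × MatIdx 1) ℂ) ^ δ ∈
      truncation 1 (rowLocus 1 ⊥) δ δ (lastWeight 1 δ) := by
  classical
  rw [mem_truncation_iff]
  refine ⟨?_, ?_, ?_, ?_⟩
  · exact (mem_homogeneousSubmodule δ _).mpr (isHomogeneous_X_pow _ _)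
  · apply Ideal.pow_mem_pow
    rw [MvPolynomial.mem_vanishingIdeal_iff]
    intro x hx
    rw [aeval_X]
    have h := hx (iLast 1)
    rw [Submodule.mem_bot] at h
    exact congrFun h (iLast 1)
  · rw [mem_stabInvariants_iff]
    intro M hM
    rw [map_pow, aeval_X, sum_matIdx_one]
    change (M (iLast 1) (iLast 1) • (X (iLast 1, iLast 1) : MvPolynomial (MatIdx 1 × MatIdx 1) ℂ)) ^ δ =
      X (iLast 1, iLast 1) ^ δ
    rw [apply_eq_one_of_linSubst_detFormLex_one hM, one_smul]
  · rw [mem_borelSemiInvariants_iff]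
    intro g hg
    rw [map_pow, aeval_X, sum_matIdx_one]
    change (((g⁻¹ : GL (MatIdx 1) ℂ) : Matrix (MatIdx 1) (MatIdx 1) ℂ) (iLast 1) (iLast 1) •
        (X (iLast 1, iLast 1) : MvPolynomial (MatIdx 1 × MatIdx 1) ℂ)) ^ δ =
      weightChar (lastWeight 1 δ) g • X (iLast 1, iLast 1) ^ δ
    rw [inv_apply_diag_of_isUpperTriangular' hg, smul_pow, weightChar_lastWeight]

/-- **`T ⊆ ℂ·A^n` at `m = 1`** (one variable: a form of degree `n` is a multiple of `A^n`),
whatever the locus, threshold and weight. [folklore] -/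
theorem truncation_one_le_span (L : Set (MatIdx 1 × MatIdx 1 → ℂ)) (t n : ℕ) (χ : Weight (MatIdx 1)) :
    truncation 1 L t n χ ≤ ℂ ∙ ((X pOne : MvPolynomial (MatIdx 1 × MatIdx 1) ℂ) ^ n) := by
  classical
  intro G hG
  rw [mem_truncation_iff] at hG
  obtain ⟨hH, -, -, -⟩ := hG
  rw [Submodule.mem_span_singleton]
  refine ⟨coeff (Finsupp.single pOne n) G, ?_⟩
  have hsupp : ∀ e ∈ G.support, e = Finsupp.single pOne n := by
    intro e he
    have hdeg : e.degree = n := by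
      rw [Finsupp.degree_eq_weight_one]
      exact (mem_homogeneousSubmodule n G).mp hH (mem_support_iff.mp he)
    have he1 : e = Finsupp.single pOne (e pOne) := by
      ext q
      rw [eq_pOne q, Finsupp.single_eq_same]
    rw [he1] at hdeg ⊢
    rw [Finsupp.degree_single] at hdeg
    rw [hdeg]
  conv_rhs => rw [G.as_sum]
  rw [Finset.sum_subset (Finset.subset_singleton_iff'.mpr hsupp) (fun e _ he => by
    rw [notMem_support_iff.mp he, monomial_zero]), Finset.sum_singleton, X_pow_eq_monomial,
    smul_monomial, smul_eq_mul, mul_one]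

/-- **`dim T = 1` at `m = 1`, `U = 0`, for every `δ`.** [folklore] -/
theorem finrank_truncation_one (δ : ℕ) :
    Module.finrank ℂ (truncation 1 (rowLocus 1 ⊥) δ δ (lastWeight 1 δ)) = 1 := by
  classical
  have hle := truncation_one_le_span (rowLocus 1 ⊥) δ δ (lastWeight 1 δ)
  haveI : FiniteDimensional ℂ (ℂ ∙ ((X pOne : MvPolynomial (MatIdx 1 × MatIdx 1) ℂ) ^ δ)) :=
    FiniteDimensional.span_singleton ℂ _
  haveI : FiniteDimensional ℂ (truncation 1 (rowLocus 1 ⊥) δ δ (lastWeight 1 δ)) :=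
    Submodule.finiteDimensional_of_le hle
  apply le_antisymm
  · exact (Submodule.finrank_mono hle).trans (finrank_span_singleton (pow_ne_zero δ (X_ne_zero pOne))).le
  · rw [Nat.one_le_iff_ne_zero, ← Nat.pos_iff_ne_zero, Module.finrank_pos_iff_exists_ne_zero]
    refine ⟨⟨_, X_pow_mem_truncation_one δ⟩, fun h => ?_⟩
    have h' := congrArg Subtype.val h
    simp only [Submodule.coe_zero] at h'
    exact pow_ne_zero δ (X_ne_zero pOne) h'

/-- **THE BOUND IS ATTAINED at `m = 1`** (for every `δ`): `dim T_0((δ)*) = 1 ≤ K_1((δ)*)`, so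
given the crux both sides are `1` — the constant in `K ≤ dim T` cannot be improved. [folklore] -/
theorem finrank_truncation_one_le_orbitMultiplicity (δ : ℕ) :
    Module.finrank ℂ (truncation 1 (rowLocus 1 ⊥) δ δ (lastWeight 1 δ)) ≤
      orbitMultiplicity ℂ (detFormLex ℂ 1) 1 (lastWeight 1 (1 * δ)) := by
  rw [finrank_truncation_one]
  exact one_le_orbitMultiplicity_det_lastWeight 1 δ

/-- **The strict variant is FALSE** (tightness): `m = 1`, `U = 0`, `r = 0`, `δ = 1`, `λ = (1)`:
`K_1 ≥ 1 = dim T`. [folklore] -/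
theorem valuativeBound_false_strict :
    ¬ (∀ (m : ℕ) [NeZero m] (U : Submodule ℂ (MatIdx m → ℂ)) (r : ℕ),
        (∀ u ∈ U, (Matrix.of fun a b : Fin m => u (toLex (a, b))).rank ≤ r) →
        ∀ (δ : ℕ) (lam : Nat.Partition (m * δ)), lam.parts.card ≤ m * m →
          orbitMultiplicity ℂ (detFormLex ℂ m) m (Weight.dualOfPartition (m * m) lam).toMatIdx <
            Module.finrank ℂ (truncation m (rowLocus m U) (δ * (m - r)) (m * δ)
              (Weight.dualOfPartition (m * m) lam).toMatIdx)) := by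
  intro h
  have h1 := h 1 ⊥ 0 (fun u hu => by
    rw [(Submodule.mem_bot ℂ).mp hu]
    have h0 : (Matrix.of fun a b : Fin 1 => (0 : MatIdx 1 → ℂ) (toLex (a, b))) = 0 := rfl
    rw [h0, Matrix.rank_zero]) 1 (Nat.Partition.indiscrete (1 * 1)) (card_parts_indiscrete_le 1 _)
  rw [toMatIdx_dualOfPartition_indiscrete 1 1] at h1
  have h2 : Module.finrank ℂ (truncation 1 (rowLocus 1 ⊥) (1 * (1 - 0)) (1 * 1) (lastWeight 1 (1 * 1))) = 1 :=
    finrank_truncation_one 1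
  rw [h2] at h1
  exact absurd (one_le_orbitMultiplicity_det_lastWeight 1 1) (not_le.mpr h1)

end TightAtOne

end Summit.ValiantsHypothesis.Theorems.ValuativeBoundNegative

end
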